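import Literature.AlgebraicGeometry.Motives.AffineSpaceChow
import Literature.AlgebraicGeometry.Motives.ReducedClosedSubschemeIso
import Literature.AlgebraicGeometry.Motives.VarietiesProjectiveSpaceProofs
import Literature.AlgebraicGeometry.Motives.ProjBasicOpenSubscheme
import Literature.RingTheory.MvPolynomial.VariableIdeals
import Mathlib.RingTheory.PolynomialAlgebra
import HarnessLib

/-!
# The affine cells of `ℙⁿ_k`: `Spec k[y₁,…,yₘ] ≅ 𝔸ᵐ`, the charts `D₊(xᵢ) ≅ 𝔸ⁿ`, and the cells
# `V₊(x_{m+1},…,x_n) ∩ D₊(x_m) ≅ 𝔸ᵐ`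

Infrastructure for `CH₁(ℙⁿ) = ℤ·[line]` by the cellular decomposition of projective space
(Fulton, *Intersection Theory*, Examples 1.9.1, 1.9.3):

* `affinePowerIso k m : specOver k k[y₁,…,yₘ] ≅ affinePower k m` — the iterated-product model
  `𝔸¹ ×ₖ ⋯ ×ₖ Spec k` of `Motives/AffineSpaceChow` is `Spec` of the polynomial ring, as
  `k`-schemes; hence `A_j(Spec k[y₁,…,yₘ]) = 0` for `j < m`
  (`cyclesOfDim_spec_le_ratTrivial`, from `cyclesOfDim_affinePower_le_ratTrivial'`).
* `chartι k n i : Spec k[y₁,…,yₙ] ⟶ ℙⁿ_k` — the `i`-th standard chart, an open immersion onto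
  `D₊(xᵢ)` (Mathlib `Proj.awayι` composed with the tree's `ProjectiveSpace.chartAlgEquiv`,
  Hartshorne II Prop. 2.5), and the preimages of the coordinate hyperplanes
  (`chartι_preimage_zeroLocus_X`: `chartι⁻¹ V₊(x_{i.succAbove j}) = V(yⱼ)`).
* `killHom`, `cellι k hm : Spec k[y₁,…,yₘ] ⟶ Spec k[y₁,…,yₙ]` — the closed immersion
  `yⱼ ↦ 0 (j > m)` onto `V(y_{m+1},…,yₙ)`.
* `exists_iso_preimage_basicOpen` — **the cells**: for a closed immersion `e : Y ↪ ℙⁿ_k` from a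
  reduced scheme with image the coordinate subspace `V₊(x_{m+1},…,xₙ)`, the open part of `Y` over
  `D₊(x_m)` is isomorphic to `Spec k[y₁,…,yₘ] = 𝔸ᵐ` (uniqueness of the reduced closed subscheme
  structure, `Motives/ReducedClosedSubschemeIso`); hence `A_j = 0` on it for `j < m`
  (`cyclesOfDim_preimage_basicOpen_le_ratTrivial`).

Everything is proved; no named facts.

## References

* W. Fulton, *Intersection Theory*, 2nd ed. (1998), §1.9, Examples 1.9.1, 1.9.3. [Fulton1998]
* R. Hartshorne, *Algebraic Geometry*, II Prop. 2.5, II Example 3.2.6. [Hartshorne1977]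
-/

noncomputable section

open CategoryTheory AlgebraicGeometry Order TopologicalSpace MonoidalCategory Limits
open scoped TensorProduct Polynomial

universe u

namespace Literature.AlgebraicGeometry.Motives

/-! ### `Spec k[y₁,…,yₘ] ≅ 𝔸¹ ×ₖ ⋯ ×ₖ Spec k` -/

namespace AffineLineProduct

variable (k : Type u) [Field k]

/-- `Spec` of a `k`-algebra isomorphism `R ≃ₐ[k] S`, as an isomorphism `Spec S ≅ Spec R` of
`k`-schemes. [folklore] -/
def specOverIsoOfAlgEquiv {R S : Type u} [CommRing R] [CommRing S] [Algebra k R] [Algebra k S]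
    (ψ : R ≃ₐ[k] S) : specOver k S ≅ specOver k R :=
  Over.isoMk (Scheme.Spec.mapIso ψ.toRingEquiv.toCommRingCatIso.op) (by
    change Spec.map (CommRingCat.ofHom ψ.toRingEquiv.toRingHom) ≫
      Spec.map (CommRingCat.ofHom (algebraMap k R)) = Spec.map (CommRingCat.ofHom (algebraMap k S))
    rw [← Spec.map_comp, ← CommRingCat.ofHom_comp]
    congr 2
    ext r
    simp)

/-- `Spec (S ⊗ₖ T) ≅ Spec S ×ₖ Spec T` as `k`-schemes (Mathlib `pullbackSpecIso`). [folklore] -/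
def specOverTensorIso (S T : Type u) [CommRing S] [CommRing T] [Algebra k S] [Algebra k T] :
    specOver k (S ⊗[k] T) ≅ specOver k S ⊗ specOver k T :=
  Over.isoMk (pullbackSpecIso k S T).symm (by
    change (pullbackSpecIso k S T).inv ≫ pullback.fst _ _ ≫
      Spec.map (CommRingCat.ofHom (algebraMap k S)) = Spec.map (CommRingCat.ofHom (algebraMap k _))
    rw [← Category.assoc, pullbackSpecIso_inv_fst', ← Spec.map_comp, ← CommRingCat.ofHom_comp,
      ← IsScalarTower.algebraMap_eq k S (S ⊗[k] T)])

/-- `k[y₁,…,y_{m+1}] ≃ₐ[k] k[X] ⊗ₖ k[y₁,…,yₘ]` (Mathlib `finSuccEquiv`, `polyEquivTensor`).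
[folklore] -/
def polyTensorAlgEquiv (m : ℕ) :
    MvPolynomial (Fin (m + 1)) k ≃ₐ[k] k[X] ⊗[k] MvPolynomial (Fin m) k :=
  (MvPolynomial.finSuccEquiv k m).trans
    ((polyEquivTensor k (MvPolynomial (Fin m) k)).trans (Algebra.TensorProduct.comm k _ _))

/-- `Spec k → Spec k` is the unit `k`-scheme. [folklore] -/
def specOverSelfIso : specOver k k ≅ 𝟙_ (SchemeOver k) :=
  Over.isoMk (Iso.refl _) (by
    simp only [Iso.refl_hom, Over.mk_hom, Algebra.algebraMap_self, CommRingCat.ofHom_id,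
      Spec.map_id]
    rfl)

/-- **`Spec k[y₁,…,yₘ] ≅ 𝔸¹ ×ₖ ⋯ ×ₖ Spec k` as `k`-schemes.** [folklore] -/
def affinePowerIso : ∀ m : ℕ, specOver k (MvPolynomial (Fin m) k) ≅ affinePower k m
  | 0 => (specOverIsoOfAlgEquiv k (MvPolynomial.isEmptyAlgEquiv k (Fin 0))).symm ≪≫
      specOverSelfIso k
  | m + 1 => specOverIsoOfAlgEquiv k (polyTensorAlgEquiv k m).symm ≪≫
      specOverTensorIso k k[X] (MvPolynomial (Fin m) k) ≪≫
        whiskerLeftIso (𝔸₁ k) (affinePowerIso m)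

/-- **`A_j(Spec k[y₁,…,yₘ]) = 0` for `j < m`** (`A_j(𝔸ᵐ) = 0`, Fulton §1.9, transported from the
iterated-product model). [cite: Fulton1998, §1.9 (p. 23)] -/
theorem cyclesOfDim_spec_le_ratTrivial {m j : ℕ} (hj : j < m) :
    cyclesOfDim (Spec (CommRingCat.of (MvPolynomial (Fin m) k))) j ≤
      ratTrivial (Spec (CommRingCat.of (MvPolynomial (Fin m) k))) j :=
  cyclesOfDim_le_ratTrivial_of_iso ((Over.forget _).mapIso (affinePowerIso k m))
    (cyclesOfDim_affinePower_le_ratTrivial' k hj)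

end AffineLineProduct

/-! ### The standard charts of `ℙⁿ_k` -/

namespace ProjectiveSpaceCells

open MvPolynomial HomogeneousLocalization

variable (k : Type u) [Field k] (n : ℕ)

attribute [local instance] MvPolynomial.gradedAlgebra ProjBaseChange.algebraBase

local notation "𝓐" => MvPolynomial.homogeneousSubmodule (Fin (n + 1)) k

/-- `Spec k[y₁,…,yₙ] ≅ Spec (k[x₀,…,xₙ]_{xᵢ})₀`, `Spec` of the tree's chart isomorphism
`ProjectiveSpace.chartAlgEquiv`. [cite: Hartshorne1977, II Prop. 2.5 (proof)] -/
def chartSpecIso (i : Fin (n + 1)) :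
    Spec (CommRingCat.of (MvPolynomial (Fin n) k)) ≅ Spec (CommRingCat.of (Away 𝓐 (MvPolynomial.X i))) :=
  Scheme.Spec.mapIso (ProjectiveSpace.chartAlgEquiv k i).toRingEquiv.toCommRingCatIso.op

/-- **The `i`-th standard chart `𝔸ⁿ = Spec k[y₁,…,yₙ] ⟶ ℙⁿ_k`**, `yⱼ = x_{i.succAbove j}/xᵢ`
(Mathlib `Proj.awayι` after `chartSpecIso`). [cite: Hartshorne1977, II Prop. 2.5] -/
def chartι (i : Fin (n + 1)) :
    Spec (CommRingCat.of (MvPolynomial (Fin n) k)) ⟶ Proj 𝓐 :=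
  (chartSpecIso k n i).hom ≫ Proj.awayι 𝓐 (MvPolynomial.X i) (ProjectiveSpace.X_mem i) zero_lt_one

/-- The chart is an open immersion. [cite: Hartshorne1977, II Prop. 2.5] -/
instance isOpenImmersion_chartι (i : Fin (n + 1)) : IsOpenImmersion (chartι k n i) := by
  unfold chartι
  infer_instance

/-- The image of the `i`-th chart is `D₊(xᵢ)`. [cite: Hartshorne1977, II Prop. 2.5] -/
theorem opensRange_chartι (i : Fin (n + 1)) :
    (chartι k n i).opensRange = Proj.basicOpen 𝓐 (MvPolynomial.X i) := by
  unfold chartι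
  rw [Scheme.Hom.opensRange_comp_of_isIso, Proj.opensRange_awayι]

/-- The image of the `i`-th chart is `D₊(xᵢ)` (as sets). [cite: Hartshorne1977, II Prop. 2.5] -/
theorem range_chartι (i : Fin (n + 1)) :
    Set.range (chartι k n i).base = (Proj.basicOpen 𝓐 (MvPolynomial.X i) : Set _) := by
  rw [← Scheme.Hom.coe_opensRange, opensRange_chartι]

/-- The chart isomorphism sends `x_{i.succAbove j}/xᵢ` to `yⱼ`. [folklore] -/
theorem chartAlgEquiv_isLocalizationElem (i : Fin (n + 1)) (j : Fin n) :
    ProjectiveSpace.chartAlgEquiv k i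
      (Away.isLocalizationElem (ProjectiveSpace.X_mem i) (ProjectiveSpace.X_mem (i.succAbove j))) =
      MvPolynomial.X j := by
  change ProjectiveSpace.ofChartRingHom k i (Away.mk 𝓐 (ProjectiveSpace.X_mem i) 1 _ _) = _
  rw [ProjectiveSpace.ofChartRingHom_mk, map_pow, ProjectiveSpace.dehomogenize_X_succAbove,
    pow_one]

/-- **`D₊(xᵢ) ∩ V₊(x_{i.succAbove j})` in the chart**: the preimage of the coordinate hyperplane
`V₊(x_{i.succAbove j})` under the `i`-th chart is `V(yⱼ) ⊆ Spec k[y]`. [folklore] -/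
theorem chartι_preimage_zeroLocus_X (i : Fin (n + 1)) (j : Fin n) :
    (chartι k n i).base ⁻¹'
        ProjectiveSpectrum.zeroLocus 𝓐 {(MvPolynomial.X (i.succAbove j) : MvPolynomial (Fin (n + 1)) k)} =
      PrimeSpectrum.zeroLocus {(MvPolynomial.X j : MvPolynomial (Fin n) k)} := by
  rw [chartι, Scheme.Hom.comp_base, TopCat.coe_comp, Set.preimage_comp,
    ProjSubscheme.awayι_preimage_zeroLocus 𝓐 (ProjectiveSpace.X_mem i) zero_lt_one
      (ProjectiveSpace.X_mem (i.succAbove j)) zero_lt_one]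
  change PrimeSpectrum.comap (ProjectiveSpace.chartAlgEquiv k i).toRingEquiv.toRingHom ⁻¹' _ = _
  rw [PrimeSpectrum.preimage_comap_zeroLocus, Set.image_singleton]
  exact congrArg _ (congrArg _ (chartAlgEquiv_isLocalizationElem k n i j))

/-- Preimage of a coordinate subspace `V₊(xₛ : s ∈ i.succAbove '' S)` under the `i`-th chart is
`V(yⱼ : j ∈ S)`. [folklore] -/
theorem chartι_preimage_zeroLocus_image (i : Fin (n + 1)) (S : Set (Fin n)) :
    (chartι k n i).base ⁻¹' ProjectiveSpectrum.zeroLocus 𝓐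
        ((fun j ↦ (MvPolynomial.X (i.succAbove j) : MvPolynomial (Fin (n + 1)) k)) '' S) =
      PrimeSpectrum.zeroLocus ((fun j ↦ (MvPolynomial.X j : MvPolynomial (Fin n) k)) '' S) := by
  ext p
  change (fun j ↦ (MvPolynomial.X (i.succAbove j) : MvPolynomial (Fin (n + 1)) k)) '' S ⊆
      ((chartι k n i p : ProjectiveSpectrum 𝓐).asHomogeneousIdeal : Set _) ↔
    (fun j ↦ (MvPolynomial.X j : MvPolynomial (Fin n) k)) '' S ⊆ (p.asIdeal : Set _)
  simp only [Set.image_subset_iff]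
  refine forall₂_congr fun j _ ↦ ?_
  have h := Set.ext_iff.mp (chartι_preimage_zeroLocus_X k n i j) p
  change {(MvPolynomial.X (i.succAbove j) : MvPolynomial (Fin (n + 1)) k)} ⊆
      ((chartι k n i p : ProjectiveSpectrum 𝓐).asHomogeneousIdeal : Set _) ↔
    {(MvPolynomial.X j : MvPolynomial (Fin n) k)} ⊆ (p.asIdeal : Set _) at h
  simp only [Set.singleton_subset_iff, SetLike.mem_coe] at h
  simpa only [Set.mem_preimage, SetLike.mem_coe] using h

end ProjectiveSpaceCells

/-! ### Killing the last variables: the closed immersion `𝔸ᵐ ↪ 𝔸ⁿ` onto `V(y_{m+1},…,yₙ)` -/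

namespace ProjectiveSpaceCells

open MvPolynomial

variable (k : Type u) [Field k] {n m : ℕ} (hm : m ≤ n)

/-- `k[y₁,…,yₙ] → k[y₁,…,yₘ]`, `yⱼ ↦ yⱼ (j ≤ m)`, `yⱼ ↦ 0 (j > m)` (with `0`-based `Fin` indices:
the variables of index `< m` survive). [folklore] -/
def killHom (n m : ℕ) : MvPolynomial (Fin n) k →ₐ[k] MvPolynomial (Fin m) k :=
  MvPolynomial.aeval fun j ↦ if h : (j : ℕ) < m then MvPolynomial.X ⟨j, h⟩ else 0

/-- `k[y₁,…,yₘ] → k[y₁,…,yₙ]`, `yⱼ ↦ yⱼ`, a section of `killHom`. [folklore] -/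
def keepHom : MvPolynomial (Fin m) k →ₐ[k] MvPolynomial (Fin n) k :=
  MvPolynomial.rename (Fin.castLE hm)

include hm in
/-- `killHom ∘ keepHom = id`. [folklore] -/
theorem killHom_keepHom (p : MvPolynomial (Fin m) k) : killHom k n m (keepHom k hm p) = p := by
  have h : (killHom k n m).comp (keepHom k hm) = AlgHom.id k _ := by
    refine MvPolynomial.algHom_ext fun a ↦ ?_
    simp only [AlgHom.coe_comp, Function.comp_apply, keepHom, MvPolynomial.rename_X, killHom,
      MvPolynomial.aeval_X, Fin.val_castLE, Fin.is_lt, ↓reduceDIte, Fin.eta, AlgHom.coe_id, id_eq]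
  exact congr($h p)

/-- `keepHom ∘ killHom` kills the variables of index `≥ m`. [folklore] -/
theorem keepHom_killHom [DecidablePred (· ∈ {j : Fin n | m ≤ (j : ℕ)})]
    (p : MvPolynomial (Fin n) k) :
    keepHom k hm (killHom k n m p) =
      MvPolynomial.aeval (fun j ↦ if j ∈ {j : Fin n | m ≤ (j : ℕ)} then
        (0 : MvPolynomial (Fin n) k) else MvPolynomial.X j) p := by
  have h : (keepHom k hm).comp (killHom k n m) =
      MvPolynomial.aeval (fun j ↦ if j ∈ {j : Fin n | m ≤ (j : ℕ)} then
        (0 : MvPolynomial (Fin n) k) else MvPolynomial.X j) := by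
    refine MvPolynomial.algHom_ext fun j ↦ ?_
    simp only [AlgHom.coe_comp, Function.comp_apply, killHom, MvPolynomial.aeval_X, Set.mem_setOf_eq]
    by_cases hj : (j : ℕ) < m
    · rw [dif_pos hj, if_neg (not_le.mpr hj), keepHom, MvPolynomial.rename_X]
      congr 1
    · rw [dif_neg hj, map_zero, if_pos (not_lt.mp hj)]
  exact congr($h p)

include hm in
/-- `killHom` is surjective. [folklore] -/
theorem killHom_surjective : Function.Surjective (killHom k n m) := fun p ↦
  ⟨keepHom k hm p, killHom_keepHom k hm p⟩

include hm in
/-- **`ker (yⱼ ↦ 0, j > m) = (y_{m+1}, …, yₙ)`.** [folklore] -/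
theorem ker_killHom : RingHom.ker (killHom k n m) =
    Ideal.span ((fun j ↦ (MvPolynomial.X j : MvPolynomial (Fin n) k)) '' {j : Fin n | m ≤ (j : ℕ)}) := by
  classical
  rw [← Literature.RingTheory.MvPolynomial.ker_aeval_ite_eq_span]
  ext p
  simp only [RingHom.mem_ker]
  constructor
  · intro h
    have h' := keepHom_killHom k hm p
    rw [h, map_zero] at h'
    convert h'.symm using 2
  · intro h
    have h' := keepHom_killHom k hm p
    have h0 : keepHom k hm (killHom k n m p) = 0 := by
      rw [h']; convert h using 2
    have := congrArg (killHom k n m) h0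
    rwa [killHom_keepHom, map_zero] at this

/-- **The closed immersion `𝔸ᵐ ↪ 𝔸ⁿ`, `Spec` of `killHom`.** [folklore] -/
def cellι (n m : ℕ) :
    Spec (CommRingCat.of (MvPolynomial (Fin m) k)) ⟶ Spec (CommRingCat.of (MvPolynomial (Fin n) k)) :=
  Spec.map (CommRingCat.ofHom (killHom k n m).toRingHom)

include hm in
/-- `cellι` is a closed immersion (`killHom` is surjective). [folklore] -/
theorem isClosedImmersion_cellι : IsClosedImmersion (cellι k n m) :=
  IsClosedImmersion.spec_of_surjective _ (killHom_surjective k hm)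

include hm in
/-- The image of `𝔸ᵐ ↪ 𝔸ⁿ` is `V(y_{m+1}, …, yₙ)`. [folklore] -/
theorem range_cellι : Set.range (cellι k n m).base =
    PrimeSpectrum.zeroLocus ((fun j ↦ (MvPolynomial.X j : MvPolynomial (Fin n) k)) '' {j : Fin n | m ≤ (j : ℕ)}) := by
  change Set.range (PrimeSpectrum.comap (killHom k n m).toRingHom) = _
  rw [range_comap_of_surjective _ _ (killHom_surjective k hm)]
  change PrimeSpectrum.zeroLocus ((RingHom.ker (killHom k n m) : Ideal (MvPolynomial (Fin n) k)) :
    Set (MvPolynomial (Fin n) k)) = _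
  rw [ker_killHom k hm, PrimeSpectrum.zeroLocus_span]

end ProjectiveSpaceCells

/-! ### The cells `V₊(x_{m+1},…,xₙ) ∩ D₊(x_m) ≅ 𝔸ᵐ` -/

namespace ProjectiveSpaceCells

open MvPolynomial

variable (k : Type u) [Field k] (n : ℕ)

attribute [local instance] MvPolynomial.gradedAlgebra ProjBaseChange.algebraBase

local notation "𝓐" => MvPolynomial.homogeneousSubmodule (Fin (n + 1)) k

/-- The coordinate subspace `Λₘ = V₊(x_{m+1}, …, xₙ) ⊆ ℙⁿ_k` (as a set; `Λₙ = ℙⁿ`, `Λ₁` is the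
line `x₂ = ⋯ = xₙ = 0`, `Λ₀` the point `[1:0:…:0]`). [folklore] -/
def coordSubspace (m : ℕ) : Set ↥(Proj 𝓐) :=
  ProjectiveSpectrum.zeroLocus 𝓐
    ((fun j ↦ (MvPolynomial.X j : MvPolynomial (Fin (n + 1)) k)) '' {j : Fin (n + 1) | m < (j : ℕ)})

variable {n} in
/-- For `i = m`: `m < i.succAbove j ↔ m ≤ j`. [folklore] -/
theorem lt_succAbove_iff {m : ℕ} (hm : m < n + 1) (j : Fin n) :
    m < ((⟨m, hm⟩ : Fin (n + 1)).succAbove j : ℕ) ↔ m ≤ (j : ℕ) := by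
  by_cases hj : (j : ℕ) < m
  · rw [Fin.succAbove_of_castSucc_lt _ _ (by rw [Fin.lt_def, Fin.val_castSucc]; exact hj),
      Fin.val_castSucc]
    omega
  · rw [Fin.succAbove_of_le_castSucc _ _ (by rw [Fin.le_def, Fin.val_castSucc]; exact not_lt.mp hj),
      Fin.val_succ]
    omega

variable {n} in
/-- `{j | m < j} = (m-th index).succAbove '' {j' | m ≤ j'}`. [folklore] -/
theorem image_succAbove_eq {m : ℕ} (hm : m < n + 1) :
    (fun j ↦ (MvPolynomial.X ((⟨m, hm⟩ : Fin (n + 1)).succAbove j) : MvPolynomial (Fin (n + 1)) k)) ''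
        {j : Fin n | m ≤ (j : ℕ)} =
      (fun j ↦ (MvPolynomial.X j : MvPolynomial (Fin (n + 1)) k)) '' {j : Fin (n + 1) | m < (j : ℕ)} := by
  ext f
  simp only [Set.mem_image, Set.mem_setOf_eq]
  constructor
  · rintro ⟨j, hj, rfl⟩
    exact ⟨_, (lt_succAbove_iff hm j).mpr hj, rfl⟩
  · rintro ⟨j, hj, rfl⟩
    have hne : j ≠ ⟨m, hm⟩ := fun h ↦ by simp [h] at hj
    obtain ⟨j', rfl⟩ := Fin.exists_succAbove_eq hne
    exact ⟨j', (lt_succAbove_iff hm j').mp hj, rfl⟩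

variable {n} in
/-- **`Λₘ ∩ D₊(xₘ)` in the `m`-th chart is `V(yₘ₊₁, …, yₙ)`**, the image of `𝔸ᵐ ↪ 𝔸ⁿ`. [folklore] -/
theorem chartι_preimage_coordSubspace {m : ℕ} (hm : m < n + 1) :
    (chartι k n ⟨m, hm⟩).base ⁻¹' coordSubspace k n m = Set.range (cellι k n m).base := by
  rw [range_cellι k (Nat.lt_succ_iff.mp hm), coordSubspace, ← image_succAbove_eq k hm,
    ← chartι_preimage_zeroLocus_image]

variable {n} in
/-- The `m`-th chart as an isomorphism onto the open subscheme `D₊(xₘ)`. [folklore] -/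
def chartIsoBasicOpen (i : Fin (n + 1)) :
    Spec (CommRingCat.of (MvPolynomial (Fin n) k)) ≅ ↑(Proj.basicOpen 𝓐 (MvPolynomial.X i)) :=
  IsOpenImmersion.isoOfRangeEq (chartι k n i) (Proj.basicOpen 𝓐 (MvPolynomial.X i)).ι
    (by rw [range_chartι, Scheme.Opens.range_ι])

variable {n} in
/-- `chartIsoBasicOpen ≫ ι = chartι`. [folklore] -/
theorem chartIsoBasicOpen_hom_ι (i : Fin (n + 1)) :
    (chartIsoBasicOpen k i).hom ≫ (Proj.basicOpen 𝓐 (MvPolynomial.X i)).ι = chartι k n i :=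
  IsOpenImmersion.isoOfRangeEq_hom_fac _ _ _

variable {n} in
/-- Pointwise form of `chartIsoBasicOpen_hom_ι`. [folklore] -/
theorem chartIsoBasicOpen_hom_apply (i : Fin (n + 1))
    (p : ↥(Spec (CommRingCat.of (MvPolynomial (Fin n) k)))) :
    ((chartIsoBasicOpen k i).hom p).1 = chartι k n i p := by
  rw [← Scheme.Opens.ι_apply, ← Scheme.Hom.comp_apply, chartIsoBasicOpen_hom_ι]

variable {n} in
/-- The points of the open subscheme `D₊(xₘ)` lying on `Λₘ` are exactly the image of
`𝔸ᵐ ↪ 𝔸ⁿ ≅ D₊(xₘ)`. [folklore] -/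
theorem range_cellι_comp_chartIsoBasicOpen {m : ℕ} (hm : m < n + 1) :
    Set.range (cellι k n m ≫ (chartIsoBasicOpen k (⟨m, hm⟩ : Fin (n + 1))).hom).base =
      (Proj.basicOpen 𝓐 (MvPolynomial.X (⟨m, hm⟩ : Fin (n + 1)))).ι.base ⁻¹'
        coordSubspace k n m := by
  set i : Fin (n + 1) := ⟨m, hm⟩
  ext u
  simp only [Set.mem_range, Set.mem_preimage, Scheme.Hom.comp_apply]
  constructor
  · rintro ⟨p, rfl⟩
    rw [Scheme.Opens.ι_apply, chartIsoBasicOpen_hom_apply, ← Set.mem_preimage,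
      chartι_preimage_coordSubspace]
    exact ⟨p, rfl⟩
  · intro hu
    obtain ⟨p, hp⟩ := (chartIsoBasicOpen k i).hom.homeomorph.surjective u
    change (chartIsoBasicOpen k i).hom p = u at hp
    rw [Scheme.Opens.ι_apply, ← hp, chartIsoBasicOpen_hom_apply, ← Set.mem_preimage,
      chartι_preimage_coordSubspace] at hu
    obtain ⟨q, hq⟩ := hu
    exact ⟨q, by rw [hq, hp]⟩

/-- The points of `e ⁻¹ᵁ U ⟶ U` hit exactly the points of `U` in the image of `e`. [folklore] -/
theorem range_morphismRestrict {X Y : Scheme.{u}} (e : X ⟶ Y) (U : Y.Opens) :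
    Set.range (e ∣_ U).base = U.ι.base ⁻¹' Set.range e.base := by
  ext u
  simp only [Set.mem_range, Set.mem_preimage]
  constructor
  · rintro ⟨x, rfl⟩
    exact ⟨x.1, by rw [Scheme.Opens.ι_apply, morphismRestrict_base_coe]⟩
  · rintro ⟨x, hx⟩
    rw [Scheme.Opens.ι_apply] at hx
    have hxU : x ∈ e ⁻¹ᵁ U := by
      change e x ∈ U
      rw [hx]; exact u.2
    exact ⟨⟨x, hxU⟩, Subtype.ext (by rw [morphismRestrict_base_coe]; exact hx)⟩

variable {n} in
/-- **The cells of `ℙⁿ`.** For a closed immersion `e : Y ↪ ℙⁿ_k` from a reduced scheme whose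
image is the coordinate subspace `Λₘ = V₊(x_{m+1}, …, xₙ)` (`m ≤ n`), the open subscheme of `Y`
over `D₊(xₘ)` is isomorphic to `𝔸ᵐ = Spec k[y₁, …, yₘ]` (both are reduced closed subschemes of
`D₊(xₘ) ≅ 𝔸ⁿ` with support `Λₘ ∩ D₊(xₘ) = V(yₘ₊₁, …, yₙ)`; Fulton Example 1.9.3: "`Lᵏ - Lᵏ⁻¹`
is an affine space"). [cite: Fulton1998, Example 1.9.3] -/
theorem exists_iso_preimage_basicOpen {Y : Scheme.{u}} [IsReduced Y]
    (e : Y ⟶ Proj 𝓐) [IsClosedImmersion e] {m : ℕ} (hm : m < n + 1)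
    (hrange : Set.range e.base = coordSubspace k n m) :
    Nonempty (↑(e ⁻¹ᵁ Proj.basicOpen 𝓐 (MvPolynomial.X (⟨m, hm⟩ : Fin (n + 1)))) ≅
      Spec (CommRingCat.of (MvPolynomial (Fin m) k))) := by
  set i : Fin (n + 1) := ⟨m, hm⟩
  haveI := isClosedImmersion_cellι k (n := n) (m := m) (Nat.lt_succ_iff.mp hm)
  obtain ⟨ε, -⟩ := exists_iso_of_isClosedImmersion_of_range_eq
    (cellι k n m ≫ (chartIsoBasicOpen k i).hom) (e ∣_ Proj.basicOpen 𝓐 (MvPolynomial.X i))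
    (by rw [range_cellι_comp_chartIsoBasicOpen, range_morphismRestrict, hrange])
  exact ⟨ε⟩

variable {n} in
/-- **`A_j` of a cell vanishes below its dimension**: in the situation of
`exists_iso_preimage_basicOpen`, every `j`-cycle (`j < m`) on the open part of `Y` over `D₊(xₘ)`
is rationally equivalent to zero. [cite: Fulton1998, §1.9 and Example 1.9.3] -/
theorem cyclesOfDim_preimage_basicOpen_le_ratTrivial {Y : Scheme.{u}} [IsReduced Y]
    (e : Y ⟶ Proj 𝓐) [IsClosedImmersion e] {m : ℕ} (hm : m < n + 1)
    (hrange : Set.range e.base = coordSubspace k n m) {j : ℕ} (hj : j < m) :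
    cyclesOfDim (↑(e ⁻¹ᵁ Proj.basicOpen 𝓐 (MvPolynomial.X (⟨m, hm⟩ : Fin (n + 1)))) : Scheme.{u}) j ≤
      ratTrivial (↑(e ⁻¹ᵁ Proj.basicOpen 𝓐 (MvPolynomial.X (⟨m, hm⟩ : Fin (n + 1)))) : Scheme.{u}) j := by
  obtain ⟨ε⟩ := exists_iso_preimage_basicOpen k e hm hrange
  exact cyclesOfDim_le_ratTrivial_of_iso ε (AffineLineProduct.cyclesOfDim_spec_le_ratTrivial k hj)

end ProjectiveSpaceCells

end Literature.AlgebraicGeometry.Motives
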